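import Summits.BirchSwinnertonDyer.BirchSwinnertonDyer.Theorems.ThetaPartnerAtTwoSignedMainConjectureCMTwoRankZeroPTDeepTransferTools
import Literature.NumberTheory.EllipticCurves.CyclotomicLayerTatePairing
import Literature.NumberTheory.EllipticCurves.BSDConductorProofs
import Literature.NumberTheory.DiophantineGeometry.LocalReductionFiniteBadPlacesProofs
import HarnessLib

/-!
# Route `ThetaPartnerAtTwo` (TP2), crux K2R0P♭ `SignedMainConjectureCMTwoRankZeroOfPubOfFlat` (item stmt-BirchSwinnertonDyer-26471; derived
# node K2r0P stmt-BirchSwinnertonDyer-24945), line `rankzero` v20, stub `stub_poitouTateDeepTwo` — **hypothesis (T) «transfer» of the `hE`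
# socket** (`SignedLowerOffTwo.PTDeep.levelwisePoitouTate_of_transfer`, file `…PTDeepSelmerSocket.lean`), with `m₀ = 0`

HONEST FRAMING (cell `pub/bsd-wall`, W-ALL row 1; extra width seat `bsd-wall-tp2-p2-w5` g2 re-deriving the statement file of width seat
`bsd-wall-tp2-p2-w2` g4's brick (T) from its landed tools `…PTDeepTransferTools.lean`; `--supports` only). THEOREMS ONLY (no definition,
no named fact, no instance, no `sorry`); closes no item by itself; BSD is NOT proved by any of this.

## The theorem
`transfer_two` = the hypothesis `hT` of `levelwisePoitouTate_of_transfer` VERBATIM, witnessed with `m₀ = 0`: for `v ∋ 2`, `A/ℚ` (on the habitat: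
globally minimal, CM, analytic rank `0`, good supersingular at `2`, `a₂ = 0` — none of which is used), the cyclotomic `ℤ₂`-extension `κ`, every
functional `z : E(ℚ_{∞,v}) →+ ℤ₂` whose Kummer values kill `res_v Sel⁺(A/ℚ_∞)` (hypothesis H(z)), every layer `n`, level `k`, class
`b ∈ H¹(ℚ_n, A[2^k])` and point `Q ∈ E⁺(ℚ_{n,v})` with: [unr] `b` unramified outside `{2} ∪ bad`, [bad] `b` locally trivial at the bad odd places,
[inf] locally trivial at `∞`, [kum] `loc_v b` = the layer Kummer class of `Q` — one has `z(Q) ≡ 0 (mod 2^k)`.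

## The proof (design memo `Cruxes/SignedMainConjectureCMTwoRankZeroOfPub/PT-DEEP-HALF-DESIGN-w2g4.md` §9)
Push `b` along `A[2^k] ↪ A[2^∞]` to `y ∈ H¹(ℚ_n, A[2^∞])`. By [kum] the pushed class has a Kummer witness `(φ, R)` with `2^k R = Q`
(`exists_kummerWitness_push_of_layerLoc_eq_layerKummer`), and all its `Γ_ℚ`-conjugates satisfy Kobayashi's signed Kummer condition at the one place
above `2` (`conjH1_mem_localKummerOverOfEmb_signed`, `E⁺(ℚ_{n,v})` being `Γ_v`-stable); [bad]/[inf] give the classical local conditions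
(`conjH1_push_mem_localKerOver_of_resOfLe_decomp(_)_eq_zero`), [unr] gives unramifiedness over `ℚ_∞` at the good odd places
(`resOfLe_kerSubgroup_inertia_conjH1_push_eq_zero`); no good odd place splits completely in the cyclotomic tower
(`localSubgroup_kerSubgroup_ne_top_of_isCyclotomic`). Hence `y ∈ Sel⁺(A/ℚ_n)` (B5c-core `mem_signedSelmerLayer_of_local_data` with `S` = the bad
places), and H(z) read at the layer (B1 `kummerValue_eq_zero_of_signedSelmerLayer`) at the witness `(φ, R)` gives `(z(2^k R) mod 2^k)·2^{-k} = 0`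
in `ℚ/ℤ`, i.e. `z(Q) ≡ 0 (mod 2^k)` (`SignedKatoOffTwo.KummerPoint.zmod_eq_of_val_smul_invPow_eq`). No torsion defect: `m₀ = 0`.

References: [Kobayashi2003] Def. 1.1, §2 (p. 4), (7.17)–(7.21), Thm. 7.3 (pp. 12–13); [GreenbergLNM1716] §2 (p. 70), §3 Lemma 3.3 (p. 86);
[MilneADT2006] Ch. I Thm. 4.10 (b).
-/

set_option autoImplicit false
-- the Theorems namespace of this sub repeats the summit name by design (D-0017 nested layout)
set_option linter.dupNamespace false

noncomputable section

open scoped Classical NumberField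

namespace Summit.BirchSwinnertonDyer.BirchSwinnertonDyer.Theorems

namespace SignedLowerOffTwo.PTDeep

open NumberField IsDedekindDomain Field IsDedekindDomain.HeightOneSpectrum WeierstrassCurve
  Literature.NumberTheory.EllipticCurves Literature.NumberTheory.GaloisRepresentations
  Literature.NumberTheory.EllipticCurves.GreenbergSelmer Literature.NumberTheory.EllipticCurves.Kobayashi2003
  Literature.NumberTheory.EllipticCurves.Sprung2012 Literature.NumberTheory.EllipticCurves.CyclotomicLayer
  Literature.NumberTheory.EllipticCurves.Rank1Residual ZpExtension Summit.BirchSwinnertonDyer.Rank1Residual.Supersingular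

/-- **(T) «transfer», `m₀ = 0`** — the hypothesis `hT` of `levelwisePoitouTate_of_transfer` (…PTDeepSelmerSocket.lean), verbatim: the Kummer
values of `z` on `E⁺(ℚ_{n,v})` vanish modulo `2^k` at every point `Q` whose layer Kummer class is the localisation of a class
`b ∈ H¹(ℚ_n, A[2^k])` that is unramified outside `{2} ∪ bad`, locally trivial at the bad odd places and at `∞` — because the push of `b` to
`A[2^∞]` lies in Kobayashi's `Sel⁺(A/ℚ_n)` and H(z) kills the Kummer values on `res_v Sel⁺(A/ℚ_n)` (read at the layer). See the module docstring.
[cite: Kobayashi2003, Def. 1.1, (7.17)–(7.21), Thm. 7.3 (pp. 12–13)] [cite: GreenbergLNM1716, §2 (p. 70) and §3 Lemma 3.3 (p. 86)] -/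
theorem transfer_two :
    ∀ (v : HeightOneSpectrum (𝓞 ℚ)), ((2 : ℕ) : 𝓞 ℚ) ∈ v.asIdeal →
      ∀ (A : WeierstrassCurve ℚ) [A.IsElliptic] [A.IsGloballyMinimal],
        A.HasCM → A.analyticRank = 0 → GoodSS A 2 → A.frobeniusTrace 2 = 0 →
        ∀ (κ : ZpExtension ℚ 2), κ.IsCyclotomic →
        ∃ m₀ : ℕ,
          ∀ z : localTowerPointsOfEmb κ (closureEmb (K := ℚ) (v.adicCompletion ℚ)) A →+ ℤ_[2],
            (∀ (t : A.subgroupH1 2 κ.kerSubgroup), t ∈ signedSelmerInfty A κ 1 →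
              ∀ (φ : contOneCocycles (discreteTopRep κ.kerSubgroup (A.geomPrimaryTorsion 2)))
                (Q : localPoints A (v.adicCompletion ℚ)) (k : ℕ), oneCocycleClass _ φ = t →
              ∀ hQ : 2 ^ k • Q ∈ (⨆ n, signedLocalPoints κ (v.adicCompletion ℚ) A 1 n),
              (∀ τ : localSubgroupOfEmb κ.kerSubgroup (closureEmb (K := ℚ) (v.adicCompletion ℚ)),
                pointsMapOfEmb A (closureEmb (K := ℚ) (v.adicCompletion ℚ))
                    ((φ.1 (resGalSubgroupOfEmb κ.kerSubgroup _ τ) : A.geomPrimaryTorsion 2) : A.geomPoints) =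
                  (τ : Field.absoluteGaloisGroup (v.adicCompletion ℚ)) • Q - Q) →
              (PadicInt.toZModPow k
                  (z ⟨2 ^ k • Q, SignedKatoOffTwo.KummerPoint.iSup_signedLocalPoints_le_localTowerPointsOfEmb A 2 κ 1 v hQ⟩)).val •
                ((((2 : ℚ) ^ k)⁻¹ : ℚ) : AddCircle (1 : ℚ)) = 0) →
            ∀ (n k : ℕ) (b : A.torsionH1Over ((2 : ℤ) ^ k) (κ.layerSubgroup n)) (Q : localPoints A (v.adicCompletion ℚ))
              (hQ : Q ∈ signedLocalPointsOfEmb κ (closureEmb (K := ℚ) (v.adicCompletion ℚ)) A 1 n),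
              -- [unr] unramified outside `S_A`
              (∀ w : HeightOneSpectrum (𝓞 ℚ), w ∉ ({u : HeightOneSpectrum (𝓞 ℚ) | ((2 : ℕ) : 𝓞 ℚ) ∈ u.asIdeal} ∪ A.badPlaces (𝓞 ℚ)) →
                ∀ 𝔓 ∈ w.primesAbove,
                  resLe (A.torsionGaloisModule ((2 : ℤ) ^ k)).toTopRep
                    (inf_le_left : κ.layerSubgroup n ⊓ 𝔓.inertia (absoluteGaloisGroup ℚ) ≤ κ.layerSubgroup n) 1 b = 0) →
              -- [bad] locally trivial at the bad odd places (all conjugates)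
              (∀ w ∈ A.badPlaces (𝓞 ℚ), ((2 : ℕ) : 𝓞 ℚ) ∉ w.asIdeal → ∀ σ : absoluteGaloisGroup ℚ,
                resOfLe (geomTorsion A ((2 : ℤ) ^ k)) (inf_le_left : κ.layerSubgroup n ⊓ decomp w ≤ κ.layerSubgroup n)
                  (conjH1 (κ.layerSubgroup n) (geomTorsion A ((2 : ℤ) ^ k)) σ b) = 0) →
              -- [inf] locally trivial at the infinite place (all conjugates)
              (∀ (w : InfinitePlace ℚ) (σ : absoluteGaloisGroup ℚ),
                resOfLe (geomTorsion A ((2 : ℤ) ^ k)) (inf_le_left : κ.layerSubgroup n ⊓ decompInf w ≤ κ.layerSubgroup n)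
                  (conjH1 (κ.layerSubgroup n) (geomTorsion A ((2 : ℤ) ^ k)) σ b) = 0) →
              -- [kum] the layer localisation at `v` is the Kummer class of `Q`
              layerLoc A (2 ^ k) κ v n b = layerKummer A (2 ^ k) κ v n ⟨Q, signedLocalPointsOfEmb_le κ _ A 1 n hQ⟩ →
              PadicInt.toZModPow k ((2 : ℤ_[2]) ^ m₀ *
                z ⟨Q, localLayerPointsOfEmb_le_localTowerPointsOfEmb κ _ A n (signedLocalPointsOfEmb_le κ _ A 1 n hQ)⟩) = 0 := by
  intro v hv A _ _ _ _ _ _ κ hκ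
  refine ⟨0, fun z hz n k b Q hQ hunr hbad hinf hkum ↦ ?_⟩
  haveI : NeZero ((2 : ℕ) ^ k) := ⟨pow_ne_zero k two_ne_zero⟩
  have hQn : Q ∈ localLayerPointsOfEmb κ (closureEmb (K := ℚ) (v.adicCompletion ℚ)) A n :=
    signedLocalPointsOfEmb_le κ _ A 1 n hQ
  -- the finite set `S` of bad places of `A`
  set S : Finset (HeightOneSpectrum (𝓞 ℚ)) := (A.finite_badPlaces_holds (𝓞 ℚ)).toFinset with hSdef
  have hmemS : ∀ w : HeightOneSpectrum (𝓞 ℚ), w ∈ S ↔ w ∈ A.badPlaces (𝓞 ℚ) := fun w ↦ Set.Finite.mem_toFinset _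
  -- the pushed class `y ∈ H¹(ℚ_n, A[2^∞])` lies in `Sel⁺(A/ℚ_n)`
  have hsel : resH1Hom (N := A.geomPrimaryTorsion 2) (subgroupInclusion (le_refl (κ.layerSubgroup n)))
        (AddSubgroup.inclusion (AcSigned.geomTorsion_zpow_le_geomPrimaryTorsion A 2 k)) (fun _ _ ↦ rfl) b ∈
      signedSelmerLayer A κ 1 n := by
    refine mem_signedSelmerLayer_of_local_data κ A 1 S (fun w hw _ ↦ ?_) (fun w _ h2w ↦ ?_) _
      (fun w h2w σ ↦ ?_) (fun w hwS h2w σ ↦ ?_) (fun w σ ↦ ?_) (fun w hwS h2w σ ↦ ?_)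
    · -- `w ∉ S` ⇒ good reduction
      by_contra hng
      exact hw ((hmemS w).2 hng)
    · -- no good odd place splits completely in `ℚ_∞/ℚ`
      exact localSubgroup_kerSubgroup_ne_top_of_isCyclotomic w κ hκ h2w
    · -- (p): `w ∋ 2` is THE place `v`; signed Kummer condition for all conjugates
      have hwv : w = v :=
        ((natCast_mem_asIdeal_iff_eq_primesEquiv_symm w Nat.prime_two).1 h2w).trans
          ((natCast_mem_asIdeal_iff_eq_primesEquiv_symm v Nat.prime_two).1 hv).symm
      subst hwv
      exact conjH1_mem_localKummerOverOfEmb_signed A κ w hκ h2w 1 n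
        (push_mem_localKummerOverOfEmb_of_layerLoc_eq_layerKummer A κ w n k b Q hQn hkum _ hQ) σ
    · -- (S): locally trivial at the bad odd places
      exact conjH1_push_mem_localKerOver_of_resOfLe_decomp_eq_zero A 2 κ w b σ (hbad w ((hmemS w).1 hwS) h2w σ)
    · -- (∞)
      exact conjH1_push_mem_localKerOver_infinitePlace_of_resOfLe_decompInf_eq_zero A 2 κ w b σ (hinf w σ)
    · -- (ur): unramified over `ℚ_∞` at the good odd places
      refine resOfLe_kerSubgroup_inertia_conjH1_push_eq_zero A 2 κ w b (hunr w fun h ↦ ?_) σ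
      rcases h with h | h
      · exact h2w h
      · exact hwS ((hmemS w).2 h)
  -- the Kummer witness `(φ, R)` of the pushed class, `2^k R = Q`
  obtain ⟨φ, R, hφ, hR, hloc⟩ := exists_kummerWitness_push_of_layerLoc_eq_layerKummer A κ v n k b Q hQn hkum
  have hRQ : 2 ^ k • R ∈ signedLocalPoints κ (v.adicCompletion ℚ) A 1 n := by
    rw [hR]; exact hQ
  -- H(z) read at the layer `n`, at the witness
  have h1 := kummerValue_eq_zero_of_signedSelmerLayer A 2 κ 1 v z hz n hsel φ R k hφ hRQ hloc
  have hpt : (⟨2 ^ k • R, localLayerPointsOfEmb_le_localTowerPointsOfEmb κ _ A n (signedLocalPointsOfEmb_le κ _ A 1 n hRQ)⟩ :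
        localTowerPointsOfEmb κ (closureEmb (K := ℚ) (v.adicCompletion ℚ)) A) =
      ⟨Q, localLayerPointsOfEmb_le_localTowerPointsOfEmb κ _ A n (signedLocalPointsOfEmb_le κ _ A 1 n hQ)⟩ :=
    Subtype.ext hR
  rw [hpt] at h1
  -- `m₀ = 0`; `(x mod 2^k)·2^{-k} = 0` in `ℚ/ℤ` ⇒ `x ≡ 0 (mod 2^k)`
  rw [pow_zero, one_mul]
  refine SignedKatoOffTwo.KummerPoint.zmod_eq_of_val_smul_invPow_eq 2 ?_
  rw [ZMod.val_zero, zero_smul]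
  exact_mod_cast h1

/-! ## The general form (any elliptic `A/ℚ`) — width seat `bsd-wall-tp2-p2-w2` g4 -/

/-- `(x mod p^k) • (1/p^k) = 0` in `ℚ/ℤ` forces `x mod p^k = 0` (`1/p^k` has additive order `p^k` in `ℚ/ℤ`). [folklore] -/
theorem toZModPow_eq_zero_of_val_smul_invPow_eq_zero {p : ℕ} [Fact p.Prime] (k : ℕ) (x : ℤ_[p])
    (h : (PadicInt.toZModPow k x).val • ((((p : ℚ) ^ k)⁻¹ : ℚ) : AddCircle (1 : ℚ)) = 0) : PadicInt.toZModPow k x = 0 := by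
  haveI : NeZero (p ^ k) := ⟨pow_ne_zero k (Fact.out : p.Prime).ne_zero⟩
  have hord : addOrderOf ((((p : ℚ) ^ k)⁻¹ : ℚ) : AddCircle (1 : ℚ)) = p ^ k := by
    have hpos : 0 < p ^ k := pow_pos (Fact.out : p.Prime).pos k
    have h1 := AddCircle.addOrderOf_div_of_gcd_eq_one (p := (1 : ℚ)) (m := 1) hpos (Nat.gcd_one_left _)
    simpa [one_div] using h1
  have hdvd : addOrderOf ((((p : ℚ) ^ k)⁻¹ : ℚ) : AddCircle (1 : ℚ)) ∣ (PadicInt.toZModPow k x).val :=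
    addOrderOf_dvd_of_nsmul_eq_zero h
  rw [hord] at hdvd
  exact (ZMod.val_eq_zero _).mp (Nat.eq_zero_of_dvd_of_lt hdvd (ZMod.val_lt _))

/-- **(T) «TRANSFER», GENERAL FORM (any elliptic `A/ℚ`: no minimality / CM / rank / reduction hypotheses), `m₀ = 0`** — the statement of `transfer_two`
above without the habitat binders, in the binder shape of seat tp2-p2-w3's interface line (cell bus 2026-08-28T11:45:40Z); this is the width seat
`bsd-wall-tp2-p2-w2` g4's own proof of its brick (T) (the file's first theorem was re-derived from the same tools by seat w5 minutes earlier).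
Fix `v ∋ 2`, an elliptic `A/ℚ`, the cyclotomic `ℤ_2`-extension `κ`. If the Kummer values of a functional
`z : E(ℚ_{∞,v}) → ℤ_2` kill `res_v Sel⁺(E/ℚ_∞)` (hypothesis H(z) of `hE`, VERBATIM), then for every layer `n`, level `2^k`, class
`b ∈ H¹(Γ_n, A[2^k])` and point `Q ∈ E⁺(ℚ_n·ℚ_v)` such that
[unr] `b` is unramified outside `S_A = {2} ∪ bad` (the admissibility clause of `hE`), [bad] every conjugate of `b` is locally trivial at the bad `w ∤ 2`,
[inf] and at `∞`, and [kum] the localisation of `b` at the layer is the layer Kummer class of `Q` — one has `z(Q) ≡ 0 (mod 2^k)`.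
Proof: push `b` to `y ∈ H¹(Γ_n, A[2^∞])`; [unr]/[bad]/[inf]/[kum] become the per-place data of `mem_signedSelmerLayer_of_local_data`
(`…PTDeepTransferTools`), so `y ∈ Sel⁺(E/ℚ_n)` (B5b: unramified ⟹ locally trivial over `ℚ_∞` at good `w ∤ 2`, Greenberg L3.3; one place above `2`;
no finite place splits completely in `ℚ_∞`); then B1 (`kummerValue_eq_zero_of_signedSelmerLayer`) with the Kummer witness `(φ, R)`, `2^k R = Q`, of [kum].
HONEST FRAMING: a `--supports` theorem (K2r0P 24945 / K2R0P♭ 26471); it discharges (T) only; `hE` still needs `hSC` (Milne I 4.10(b) for the canonical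
family — PUB) and the Shapiro/Selmer-structure socket (seat w3). BSD is not proved by any of this.
[cite: Kobayashi2003, Def. 1.1, §2 (p. 4), (8.23) (p. 18)] [cite: GreenbergLNM1716, §2 (p. 70), §3 Lemma 3.3 (p. 86)] [cite: MilneADT2006, Ch. I §4, Thm. 4.10] -/
theorem transfer_two_general (v : HeightOneSpectrum (𝓞 ℚ)) (hv : ((2 : ℕ) : 𝓞 ℚ) ∈ v.asIdeal) (A : WeierstrassCurve ℚ) [A.IsElliptic]
    (κ : ZpExtension ℚ 2) (hκ : κ.IsCyclotomic) :
    ∃ m₀ : ℕ, ∀ z : localTowerPointsOfEmb κ (closureEmb (K := ℚ) (v.adicCompletion ℚ)) A →+ ℤ_[2],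
      (∀ (t : A.subgroupH1 2 κ.kerSubgroup), t ∈ signedSelmerInfty A κ 1 →
        ∀ (φ : contOneCocycles (discreteTopRep κ.kerSubgroup (A.geomPrimaryTorsion 2)))
          (Q : localPoints A (v.adicCompletion ℚ)) (k : ℕ), oneCocycleClass _ φ = t →
        ∀ hQ : 2 ^ k • Q ∈ (⨆ n, signedLocalPoints κ (v.adicCompletion ℚ) A 1 n),
        (∀ τ : localSubgroupOfEmb κ.kerSubgroup (closureEmb (K := ℚ) (v.adicCompletion ℚ)),
          pointsMapOfEmb A (closureEmb (K := ℚ) (v.adicCompletion ℚ))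
              ((φ.1 (resGalSubgroupOfEmb κ.kerSubgroup _ τ) : A.geomPrimaryTorsion 2) : A.geomPoints) =
            (τ : Field.absoluteGaloisGroup (v.adicCompletion ℚ)) • Q - Q) →
        (PadicInt.toZModPow k
            (z ⟨2 ^ k • Q, SignedKatoOffTwo.KummerPoint.iSup_signedLocalPoints_le_localTowerPointsOfEmb A 2 κ 1 v hQ⟩)).val •
          ((((2 : ℚ) ^ k)⁻¹ : ℚ) : AddCircle (1 : ℚ)) = 0) →
      ∀ (n k : ℕ) (b : A.torsionH1Over ((2 : ℤ) ^ k) (κ.layerSubgroup n)) (Q : localPoints A (v.adicCompletion ℚ))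
        (hQ : Q ∈ signedLocalPointsOfEmb κ (closureEmb (K := ℚ) (v.adicCompletion ℚ)) A 1 n),
      -- [unr] admissible: unramified outside `S_A = {w ∋ 2} ∪ A.badPlaces`
      (∀ w : HeightOneSpectrum (𝓞 ℚ), w ∉ ({u : HeightOneSpectrum (𝓞 ℚ) | ((2 : ℕ) : 𝓞 ℚ) ∈ u.asIdeal} ∪ A.badPlaces (𝓞 ℚ)) →
        ∀ 𝔓 ∈ w.primesAbove,
          resLe (A.torsionGaloisModule ((2 : ℤ) ^ k)).toTopRep
            (inf_le_left : κ.layerSubgroup n ⊓ 𝔓.inertia (absoluteGaloisGroup ℚ) ≤ κ.layerSubgroup n) 1 b = 0) →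
      -- [bad] locally trivial at the bad places prime to `2`
      (∀ w ∈ A.badPlaces (𝓞 ℚ), ((2 : ℕ) : 𝓞 ℚ) ∉ w.asIdeal → ∀ σ : absoluteGaloisGroup ℚ,
        resOfLe (A.geomTorsion ((2 : ℤ) ^ k)) (inf_le_left : κ.layerSubgroup n ⊓ decomp (K := ℚ) w ≤ κ.layerSubgroup n)
          (conjH1 (κ.layerSubgroup n) (A.geomTorsion ((2 : ℤ) ^ k)) σ b) = 0) →
      -- [inf] locally trivial at `∞`
      (∀ (w : InfinitePlace ℚ) (σ : absoluteGaloisGroup ℚ),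
        resOfLe (A.geomTorsion ((2 : ℤ) ^ k)) (inf_le_left : κ.layerSubgroup n ⊓ decompInf (K := ℚ) w ≤ κ.layerSubgroup n)
          (conjH1 (κ.layerSubgroup n) (A.geomTorsion ((2 : ℤ) ^ k)) σ b) = 0) →
      -- [kum] the localisation at the layer is the layer Kummer class of `Q`
      CyclotomicLayer.layerLoc A (2 ^ k) κ v n b =
        CyclotomicLayer.layerKummer A (2 ^ k) κ v n ⟨Q, signedLocalPointsOfEmb_le κ _ A 1 n hQ⟩ →
      PadicInt.toZModPow k ((2 : ℤ_[2]) ^ m₀ *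
        z ⟨Q, localLayerPointsOfEmb_le_localTowerPointsOfEmb κ _ A n (signedLocalPointsOfEmb_le κ _ A 1 n hQ)⟩) = 0 := by
  refine ⟨0, fun z hz n k b Q hQ hunr hbad hinf hkum ↦ ?_⟩
  rw [pow_zero, one_mul]
  haveI : NeZero (2 ^ k) := ⟨pow_ne_zero k two_ne_zero⟩
  -- the pushed class `y ∈ H¹(Γ_n, A[2^∞])`
  set y : A.subgroupH1 2 (κ.layerSubgroup n) :=
    resH1Hom (N := A.geomPrimaryTorsion 2) (subgroupInclusion (le_refl (κ.layerSubgroup n)))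
      (AddSubgroup.inclusion (AcSigned.geomTorsion_zpow_le_geomPrimaryTorsion A 2 k)) (fun _ _ ↦ rfl) b with hy
  -- the Kummer witness of [kum]
  obtain ⟨φ, R, hφ, hR, hloc⟩ := exists_kummerWitness_push_of_layerLoc_eq_layerKummer A κ v n k b Q hQ.1 hkum
  -- `y ∈ Sel⁺(E/ℚ_n)` from the per-place data
  have hbadfin : (A.badPlaces (𝓞 ℚ)).Finite := A.finite_badPlaces_holds (𝓞 ℚ)
  have hmem : y ∈ signedSelmerLayer A κ 1 n := by
    refine mem_signedSelmerLayer_of_local_data κ A 1 hbadfin.toFinset ?_ ?_ y ?_ ?_ ?_ ?_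
    · intro w hw hw2
      rw [Set.Finite.mem_toFinset] at hw
      exact not_not.mp hw
    · intro w _ hw2
      exact localSubgroup_kerSubgroup_ne_top_of_isCyclotomic w κ hκ hw2
    · intro w hw2 σ
      rw [((natCast_mem_asIdeal_iff_eq_primesEquiv_symm w Nat.prime_two).1 hw2).trans
        ((natCast_mem_asIdeal_iff_eq_primesEquiv_symm v Nat.prime_two).1 hv).symm]
      exact conjH1_mem_localKummerOverOfEmb_signed A κ v hκ hv 1 n
        (push_mem_localKummerOverOfEmb_of_layerLoc_eq_layerKummer A κ v n k b Q hQ.1 hkum _ hQ) σ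
    · intro w hw hw2 σ
      rw [Set.Finite.mem_toFinset] at hw
      exact conjH1_push_mem_localKerOver_of_resOfLe_decomp_eq_zero A 2 κ w b σ (hbad w hw hw2 σ)
    · intro w σ
      exact conjH1_push_mem_localKerOver_infinitePlace_of_resOfLe_decompInf_eq_zero A 2 κ w b σ (hinf w σ)
    · intro w hw hw2 σ
      rw [Set.Finite.mem_toFinset] at hw
      refine resOfLe_kerSubgroup_inertia_conjH1_push_eq_zero A 2 κ w b (hunr w ?_) σ
      rw [Set.mem_union, not_or]
      exact ⟨hw2, hw⟩
  -- B1 with the witness `(φ, R)`: `z(2^k R) ≡ 0 (mod 2^k)`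
  have hRQ : 2 ^ k • R ∈ signedLocalPoints κ (v.adicCompletion ℚ) A 1 n := by rw [hR]; exact hQ
  have hB1 := kummerValue_eq_zero_of_signedSelmerLayer A 2 κ 1 v z (fun t ht ψ P j hψ hP hτ ↦ by
    have h := hz t ht ψ P j hψ hP hτ
    simpa only [Nat.cast_ofNat] using h) n hmem φ R k hφ hRQ hloc
  have hpt : (⟨2 ^ k • R, localLayerPointsOfEmb_le_localTowerPointsOfEmb κ _ A n (signedLocalPointsOfEmb_le κ _ A 1 n hRQ)⟩ :
      localTowerPointsOfEmb κ (closureEmb (K := ℚ) (v.adicCompletion ℚ)) A) =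
      ⟨Q, localLayerPointsOfEmb_le_localTowerPointsOfEmb κ _ A n (signedLocalPointsOfEmb_le κ _ A 1 n hQ)⟩ := Subtype.ext hR
  rw [hpt] at hB1
  exact toZModPow_eq_zero_of_val_smul_invPow_eq_zero k _ hB1

end SignedLowerOffTwo.PTDeep

end Summit.BirchSwinnertonDyer.BirchSwinnertonDyer.Theorems

end
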